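import Literature.MathematicalPhysics.QuantumFieldTheory.Balaban1983to89.B6Ineq2134ThetaKLevel
import Literature.MathematicalPhysics.QuantumFieldTheory.Balaban1983to89.B6Ineq2134Diag

/-!
# `Balaban1983to89.B6Ineq2134DiagKLevel` — T. Bałaban, *Propagators and renormalization transformations for lattice gauge theories. II*,
# Commun. Math. Phys. **96** (1984) 223–250 [Balaban1984PropagatorsII], p. 247: (2.134) FOR THE DIAGONAL PAIRS `K_{□,□}` OF (2.92) ON THE GENUINE
# `k`-LEVEL FAMILY — `|(K_{□,□}G_□h_□J)(x)| ≤ O(M⁻¹)e^{−½δ₂d(y,y′)}|J|` with (2.60), (2.63) and the largeness of `M` DISCHARGED, the `O(M⁻¹)` EXPLICIT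
# (`θ₀ = Θ·U/M`), `K_{□,□}` = `…B6Eq291Generator.kDiag (∂P∂*) h_□ ζ_□ M_□ P_□` BY NAME with `∂P∂*` the genuine `k`-level operator of (2.88)

statement-level skeleton of published theorems with citation tags; proofs where landed; nothing here is a claim about the Yang–Mills mass gap

PDF held: `paper:balaban1984-cmp96-propagators-rt-ii` (journal page = PDF page + 222); p. 239 [PDF 17] ((2.91)–(2.93)), p. 247 [PDF 25] ((2.133)–(2.135)),
p. 238 [PDF 16] ((2.88) and the remark on the commutator / change-of-domain terms) — read from the tree transcriptions of `…B6Eq291Generator` (p02, p. 239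
re-read as an image there), `…B6Ineq2134Diag` / `…B6Ineq2134OffDiag` (r03 g5) and `…B6Ineq2134ThetaKLevel` (p38 g24, pp. 239/247 re-read as images).
PRINT (p. 239, verbatim): *"(K_{□,□}A)_μ(x) = Σ_{b∈st(x)} (∂h_□)(b)(∂A_μ)(b) − (Δh_□)(x)A_μ(x) + a(L^jη)^{−2}(S_j*(∂h_□)Q_jA)_μ(x) − a(L^jη)^{−2}(Q_j*S_j(∂h_□)A)_μ(x)
+ (ζ_□(∂P∂* − ∂P_□∂*)h_□A)_μ(x) + (ζ_□P_{□,1}(∂h_□)A)_μ(x) (2.92) if x ∈ B^j(Λ_j) … The operators S_j, P_{□,1}(∂h_□) = [∂P_□∂*, h_□] were defined in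
(1.120)."*  p. 247: *"Applying the inequalities (2.133), (2.88) and the remarks after the inequality (2.68) we obtain |(K_{□,□′}G_{□′}h_{□′}J)(x)| ≤
O(M^{−1})e^{−½δ₂d(y,y′)}|J| (2.134) for x ∈ Δ(y), supp J ⊂ Δ(y′)"*.  p. 238: *"An estimate of the terms with the commutator is even simpler and gives a
factor O(M⁻¹)."*

CITATION HEADER (lean-in-tree rule) — WHAT IS REPRODUCED.  Phase-2 file of the `lit-balaban` typed skeleton (HOME `run/shared/lean/pub/lit-balaban/`), seat
**p38 gen 25** (free-target protocol G.5-34(d), TAKING line HOME/STATUS.md 2026-08-22T21:40Z, «bite (b′)» of B6-CLOSURE §5 item 6 — the diagonal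
companion of gen 24's bite (b) `…B6Ineq2134ThetaKLevel`); SKELETON rows **B6.Eq2.134** × **B6.Eq2.91** ((2.92)) × **B6.Prop2.6** (cells only; decls of
record untouched; owner r03, referee ref-4).  The tree's `…B6Ineq2134Diag.diag_hasMajorant` (r03 g5) DERIVES (2.134) for □ = □′ on an ABSTRACT geometry
from the displayed inputs — line 1 of (2.92) in first-order form `Σ_i c_iE_i − c₀`, lines 2 and 4 as kernel commutators `z_k(N_kh_□ − h_□N_k)` with
(2.88)-shape majorants of `N_k`, line 3 as one operator `D₃` with the p. 238 *"factor e^{−δ₀M}"* majorant, the (2.133)-shape local majorants of `G_□` and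
`E_i∘G_□`, the block-Lipschitz datum of `h_□`, (2.60), (2.63) at `(¾δ₂, ⅓)` and `L² ≤ e^{⅛δ₂RM}`.  THIS FILE INSTANTIATES IT ON THE GENUINE `k`-LEVEL FAMILY
`i : KIdx d ℓ` (P7's census geometry `geoB i` with its multiscale distance `d`, `M = L·M_h`, the (2.60)-certified `R`) over ANY fine lattice `X` with block map
`blk : X → 𝔅` (gen 24's vector fields `XV i`/`blkV i`, or the owner's bonds `BoxBond`/`blkBond` of item 6 (c), p342390) and ANY `∂P∂* =: Dg` in the
`kDiag` slot (gen 24's genuine `DP i`; it enters only line 3):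
* §1 **`ineq2134_diag_kLevel`** — for every rate `δ > 0` ONE threshold `M₀` and ONE constant `c ≥ 0` (the (2.63) constant `K261`) such that for every
  member with `L·M_h ≥ M₀` the diagonal bound holds with (2.60) `levelSep_geoB`, (2.63) `ineq263_geoB` and the largeness `thr_geoB` DISCHARGED; the
  partner `∂P_□∂*` of line 4 (`P_{□,1}(∂h_□) = [∂P_□∂*, h_□]`) is an abstract `Pl` with a (2.88)-shape majorant, the remaining inputs stay in r03's shapes;
* §2 **`ineq2134_kDiag_kLevel`** — the same FOR `K_{□,□} = …B6Eq291Generator.kDiag (∂P∂*) h_□ ζ_□ M_□ P_□` BY NAME,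
  under the displayed decomposition *"lines 1–2 of (2.92) = the commutator `h_□(Δ + Q*aQ) − (Δ + Q*aQ)h_□`"* (`hdec`), line 3 = `ζ_□(∂P∂* − ∂P_□∂*)h_□` with the
  change-of-domain majorant (`hD`), line 4 = `ζ_□[∂P_□∂*, h_□]`;
* §3 **`ineq2134_kDiag_kLevel_theta`** — THE PRINTED `O(M⁻¹)` PACKAGED: for every rate `δ > 0`, `∃ M₀, Θ ≥ 0` (on `d, L, δ`) with
  `HasMajorant (blkV i) ((K_{□,□}·G_□)·h_□) (θ₀·e^{−(δ/2)d})`, **`θ₀ = Θ·U/M`**, `U = #E·s₁C₁ + s₂C_G + (#K+1)·s·((C_N+1)C_G(1+r₀)) + C_DC_G/c_D` (every user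
  constant located; `theta_pack_le`: `8/δ + r₀ ≤ (8/δ+1)(1+r₀)`, `e^{−c_DM} ≤ (c_DM)⁻¹`) — literally the hypothesis `h2134` of
  `…B6Prop26Gluing.majorant_R_of_2134` for the pair (□, □), AT THE GIVEN RATE (the joint packaging with gen 24's off-diagonal pairs for the (2.91) family
  `kFam`/`rOp`, the threshold `N²θ₀c₁ < 1` and the special case `P_□ = ∂P∂*` with gen 24's genuine `DP i` discharged follow in the companion `…B6Ineq2134KFamKLevel`).
IMPORTS BY NAME, restating nothing; no `def`, no new hypothesis-fact; standard axioms.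
HONEST SCOPE / DIVERGENCES. (1) NOT discharged here, kept as displayed hypotheses in r03's exact shapes: the `G_□`-side (2.133) pair (`hG` value entry,
`hEG` gradient pieces `E_i∘G_□`, `hGout` — bite (a) `…B6Ineq2133TwoScaleV1` composed with the owner's geometry bridge (c)); the `h_□` data (|∂h_□|, |Δh_□|,
block-Lipschitz `(s/M)(d + r₀)`, supports — the rescaled (1.118) family; the block-lattice cover is p21's `…B6Cover236MultiLevelBlocks`, not imported); the
line-2 partners `N_k` (`a(L^jη)^{−2}Q_j*Q_j`, (2.88)/(2.6)-shape majorants) and the decomposition `hdec` itself (its one-scale lattice form is row B6.Eq2.39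
`…B6Eq239Commutator`, [4] (1.121) `…B5Averaging120`); the partner `∂P_□∂*` (print's `G_□` carries ITS OWN two-scale `P_□` on `T_□`, p. 239) and line 3 (the change-of-domain estimate *"of the type
(1.12) [3]"*, p. 238 — not in the tree at `k` levels). (2) Setting as in P7/gen 24: levels `1 … k` on a Neumann box, `m² = 0`, `L ≥ 2`, print's units `η = L^{−k}`; constants existential (on `d, L,
δ_G`); the rate bookkeeping (⅛, ¾, ⅓, the absorbed `d + r₀`) is r03's — *"The choice of factors is again arbitrary"* (p. 238).  Nothing on
d = 4 or the continuum; NOT summit progress.  Unit `lit-balaban-p38` (gen 25), 2026-08-22.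
-/

noncomputable section

namespace Literature.MathematicalPhysics.QuantumFieldTheory.Balaban1983to89.B6Ineq2134DiagKLevel

open B6Prop22KLevelCensus (KIdx)
open B6Prop22KLevelCensusEta (nK nK_pos)
open B6Ineq288MultiLevelBox (geoB geoB_M geoB_L geoB_eta geoB_RM dist_nonneg_geoB)
open B6Ineq261LevelGap (K261 K261_nonneg)
open B6RandomWalk (HasMajorant hasMajorant_mono)
open B6Prop26Gluing (mulOp mulOp_apply LocalMajorant OutLoc)
open B6Ineq268 (LevelSep)
open B6Lemma21Repaired (Ineq263With)
open B6Ineq2134Diag (diag_hasMajorant)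
open B6Ineq2134ThetaKLevel (levelSep_geoB ineq263_geoB thr_geoB)
open B6Eq291Generator (kDiag)

variable {d ℓ : ℕ}

/-! ## §0  Member facts and monotonicity helpers -/

/-- `1 ≤ R·L·M_h` for every member (`R ≥ 2L`, `M_h ≥ 1`). [cite: Balaban1984PropagatorsII, (2.2) p.224, bookkeeping] -/
private theorem one_le_RLMh (i : KIdx d ℓ) : 1 ≤ i.R * ((ℓ + 1) * i.Mh) :=
  Nat.one_le_iff_ne_zero.2 (Nat.mul_ne_zero_iff.2 ⟨by have := i.hR; omega, Nat.mul_ne_zero_iff.2 ⟨by omega, by have := i.hMh; omega⟩⟩)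

/-- the side facts of a member used by `diag_hasMajorant`: `1 ≤ L`, `0 < η`, `0 < M`, `0 ≤ RM`. [cite: Balaban1984PropagatorsII, (2.1)–(2.2) p.224, bookkeeping] -/
theorem member_facts (i : KIdx d ℓ) :
    1 ≤ (geoB i).L ∧ 0 < (geoB i).eta ∧ 0 < (geoB i).M ∧ 0 ≤ (geoB i).R * (geoB i).M := by
  refine ⟨?_, ?_, ?_, ?_⟩
  · rw [geoB_L]; linarith [(Nat.cast_nonneg ℓ : (0 : ℝ) ≤ ℓ)]
  · rw [geoB_eta]; exact inv_pos.2 (nK_pos i)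
  · rw [geoB_M]
    have h1 : (1 : ℝ) ≤ (i.Mh : ℝ) := by exact_mod_cast i.hMh
    have h2 : (0 : ℝ) < (ℓ : ℝ) + 1 := by positivity
    nlinarith
  · rw [geoB_RM]
    have : ((1 : ℕ) : ℝ) ≤ ((i.R * ((ℓ + 1) * i.Mh) : ℕ) : ℝ) := by exact_mod_cast one_le_RLMh i
    push_cast at this
    linarith

/-- monotonicity of a local majorant in the kernel. [folklore] -/
private theorem localMajorant_mono {g : B6.Geometry} {X : Type} (blk : X → g.Site) {T : Module.End ℝ (X → ℝ)} {S : Set g.Site}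
    {K K' : g.Site → g.Site → ℝ} (h : LocalMajorant blk T S K) (hle : ∀ a b, K a b ≤ K' a b) : LocalMajorant blk T S K' :=
  fun y' hy' μ B hμ x hx => (h y' hy' μ B hμ x hx).trans (mul_le_mul_of_nonneg_right (hle _ _) hμ.nonneg)

/-- lowering the rate / raising the constant of an exponential majorant on non-negative distances. [folklore] -/
private theorem expKernel_mono {c c' δ δ' t : ℝ} (hc' : 0 ≤ c') (hc : c ≤ c') (hδ : δ' ≤ δ) (ht : 0 ≤ t) :
    c * Real.exp (-(δ * t)) ≤ c' * Real.exp (-(δ' * t)) :=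
  (mul_le_mul_of_nonneg_right hc (Real.exp_nonneg _)).trans
    (mul_le_mul_of_nonneg_left (Real.exp_le_exp.2 (neg_le_neg (mul_le_mul_of_nonneg_right hδ ht))) hc')

/-! ## §1  (2.134) for □ = □′ on `geoB`: (2.60), (2.63), the largeness discharged -/

/-- **(2.134) FOR THE DIAGONAL PAIRS □ = □′ ON THE GENUINE `k`-LEVEL FAMILY** — r03's `diag_hasMajorant` with (2.60) `levelSep_geoB`, (2.63) at `(¾δ, ⅓)`
`ineq263_geoB` (constant `c = K261 N₀ (d+1) L 1 (¼δ)`) and the largeness `L² ≤ e^{⅛δRM}` `thr_geoB` DISCHARGED: for every rate `δ > 0` there are ONE threshold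
`M₀` and ONE constant `c ≥ 0` (on `d, L, δ`) such that for every member with `L·M_h ≥ M₀` and all displayed data — `G_□` (transported to the vector fields
`X`, output-localised to the reach `S`, with the (2.133)-shape local majorants `C_G(L^jη)²e^{−δd}` and, for the first-order pieces `E_i∘G_□`,
`C₁(L^jη)e^{−δd}`), line 1 of (2.92) `Σ_i c_iE_i − c₀` (`|c_i| ≤ s₁/(M·L^jη)`, `|c₀| ≤ s₂/(M·(L^jη)²)`, supported over `S`), `h_□` (`|h_□| ≤ 1` over `S`,
block-Lipschitz `(s/M)(d + r₀)`), the line-2 partners `N_k` and the line-4 partner `Pl` (= `∂P_□∂*`) with (2.88)-shape majorants `C_N(L^jη)^{−2}e^{−δd}`,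
cut-offs `|z_k|, |ζ_□| ≤ 1`, and line 3 `D₃` with the change-of-domain majorant `C_De^{−c_DM}(L^jη)^{−2}e^{−δd}` —
`HasMajorant blk ((line 1 + (Σ_k z_k[N_k, h_□]-terms + ζ_□(Pl h_□ − h_□ Pl)) + D₃)·G_□·h_□) (θ_diag·e^{−½δ d})`,
`θ_diag = (#E·s₁C₁ + s₂C_G)/M + (#K+1)·(s/M)·C_NC_GL²(8/δ + r₀)c² + C_De^{−c_DM}C_GL²c²` — r03's explicit `O(M⁻¹)` (`theta_diag_le`).
[cite: Balaban1984PropagatorsII, (2.134) p.247; (2.92) p.239; Lemma 2.1 (2.60), (2.63) p.234; (2.68) p.235 (remarks)] -/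
theorem ineq2134_diag_kLevel (d ℓ : ℕ) {δ : ℝ} (hδ : 0 < δ) :
    ∃ M₀ c : ℝ, 0 < M₀ ∧ 0 ≤ c ∧
      ∀ i : KIdx d ℓ, M₀ ≤ ((ℓ : ℝ) + 1) * i.Mh →
        ∀ {X : Type} (blk : X → (geoB i).Site),
        ∀ {CG C₁ CN CD cD s s₁ s₂ r₀ : ℝ}, 0 ≤ CG → 0 ≤ C₁ → 0 ≤ CN → 0 ≤ CD → 0 ≤ s → 0 ≤ s₁ → 0 ≤ s₂ → 0 ≤ r₀ →
        ∀ {Gl Pl D₃ : Module.End ℝ (X → ℝ)} {hI c₀ ζ : X → ℝ} {S : Set (geoB i).Site}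
          {ι : Type} (DE : Finset ι) {E : ι → Module.End ℝ (X → ℝ)} {cf : ι → X → ℝ}
          {κ : Type} (DK : Finset κ) {N : κ → Module.End ℝ (X → ℝ)} {z : κ → X → ℝ},
          LocalMajorant blk Gl S (fun y y' => CG * (geoB i).len y ^ 2 * Real.exp (-(δ * (geoB i).dist y y'))) →
          OutLoc blk Gl S →
          (∀ e ∈ DE, LocalMajorant blk (E e * Gl) S (fun y y' => C₁ * (geoB i).len y * Real.exp (-(δ * (geoB i).dist y y')))) →
          (∀ e ∈ DE, ∀ x, |cf e x| ≤ s₁ / ((geoB i).M * (geoB i).len (blk x))) → (∀ e ∈ DE, ∀ x, cf e x ≠ 0 → blk x ∈ S) →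
          (∀ x, |c₀ x| ≤ s₂ / ((geoB i).M * (geoB i).len (blk x) ^ 2)) → (∀ x, c₀ x ≠ 0 → blk x ∈ S) →
          (∀ x, |hI x| ≤ 1) → (∀ x, hI x ≠ 0 → blk x ∈ S) →
          (∀ x x', |hI x' - hI x| ≤ s / (geoB i).M * ((geoB i).dist (blk x) (blk x') + r₀)) →
          (∀ k ∈ DK, HasMajorant blk (N k) (fun y y'' => CN / (geoB i).len y ^ 2 * Real.exp (-(δ * (geoB i).dist y y'')))) →
          (∀ k ∈ DK, ∀ x, |z k x| ≤ 1) →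
          HasMajorant blk Pl (fun y y'' => CN / (geoB i).len y ^ 2 * Real.exp (-(δ * (geoB i).dist y y''))) →
          (∀ x, |ζ x| ≤ 1) →
          HasMajorant blk D₃ (fun y y'' => CD * Real.exp (-(cD * (geoB i).M)) / (geoB i).len y ^ 2 * Real.exp (-(δ * (geoB i).dist y y''))) →
          HasMajorant blk
            ((((∑ e ∈ DE, mulOp (cf e) * E e - mulOp c₀) +
                ((∑ k ∈ DK, mulOp (z k) * (N k * mulOp hI - mulOp hI * N k)) + mulOp ζ * (Pl * mulOp hI - mulOp hI * Pl))) + D₃) *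
              Gl * mulOp hI)
            (fun y y' =>
              ((DE.card * (s₁ * C₁) + s₂ * CG) / (geoB i).M +
                    (DK.card + 1) * (s / (geoB i).M * (CN * CG * (geoB i).L ^ 2 * (8 / δ + r₀)) * c ^ 2) +
                  CD * Real.exp (-(cD * (geoB i).M)) * CG * (geoB i).L ^ 2 * c ^ 2) *
                Real.exp (-(1 / 2 * δ * (geoB i).dist y y'))) := by
  classical
  -- (2.63) at `(¾δ, ⅓)`, the largeness threshold, the constant
  obtain ⟨N₀, hN₀pos, h263⟩ := ineq263_geoB d ℓ hδ
  obtain ⟨N₂, hthr⟩ := thr_geoB d ℓ hδ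
  obtain ⟨c, hc⟩ : ∃ c : ℝ, c = K261 N₀ (d + 1) ((ℓ : ℝ) + 1) 1 (1 / 3 * (3 / 4 * δ)) := ⟨_, rfl⟩
  have hcnn : 0 ≤ c := by rw [hc]; exact K261_nonneg (by positivity) zero_le_one
  obtain ⟨M₀, hM₀⟩ : ∃ M₀ : ℝ, M₀ = max ((N₀ : ℝ) + 1) ((N₂ : ℝ) + 1) := ⟨_, rfl⟩
  refine ⟨M₀, c, by rw [hM₀]; exact lt_max_of_lt_left (by positivity), hcnn, ?_⟩
  intro i hM X blk CG C₁ CN CD cD s s₁ s₂ r₀ hCG hC₁ hCN hCD hs hs₁ hs₂ hr₀ Gl Pl D₃ hI c₀ ζ S ι DE E cf κ DK N z hG hGout hEG hcf hcfS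
    hc₀ hc₀S hI1 hIS hLip hN hz hPl hζ hD
  -- the member's thresholds and side facts
  have hMN₀ : (N₀ : ℝ) + 1 ≤ ((ℓ : ℝ) + 1) * i.Mh := (le_max_left _ _).trans (hM₀ ▸ hM)
  have hMN₂ : (N₂ : ℝ) + 1 ≤ ((ℓ : ℝ) + 1) * i.Mh := (le_max_right _ _).trans (hM₀ ▸ hM)
  obtain ⟨hL1, hη, hMpos, hRM⟩ := member_facts i
  have h263i : Ineq263With c (geoB i) (3 / 4 * δ) (1 / 3) := by rw [hc]; exact h263 i hMN₀
  -- lines 2 and 4 as ONE commutator family indexed by `Option κ` (`none` = the line-4 partner `∂P_□∂*`)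
  have hN'maj : ∀ o ∈ Finset.insertNone DK, HasMajorant blk ((fun o : Option κ => o.elim Pl N) o)
      (fun y y'' => CN / (geoB i).len y ^ 2 * Real.exp (-(δ * (geoB i).dist y y''))) := by
    intro o ho
    cases o with
    | none => exact hPl
    | some k => exact hN k (Finset.some_mem_insertNone.1 ho)
  have hz'le : ∀ o ∈ Finset.insertNone DK, ∀ x, |(fun o : Option κ => o.elim ζ z) o x| ≤ 1 := by
    intro o ho x
    cases o with
    | none => exact hζ x
    | some k => exact hz k (Finset.some_mem_insertNone.1 ho) x
  have hsum : (∑ k ∈ DK, mulOp (z k) * (N k * mulOp hI - mulOp hI * N k)) + mulOp ζ * (Pl * mulOp hI - mulOp hI * Pl) =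
      ∑ o ∈ Finset.insertNone DK,
        mulOp ((fun o : Option κ => o.elim ζ z) o) *
          ((fun o : Option κ => o.elim Pl N) o * mulOp hI - mulOp hI * (fun o : Option κ => o.elim Pl N) o) := by
    rw [Finset.sum_insertNone]
    exact add_comm _ _
  have key := diag_hasMajorant blk hL1 hη (levelSep_geoB i) (dist_nonneg_geoB i) hδ hCG hC₁ hCN hCD hs hs₁ hs₂ hr₀ hMpos hRM
    (hthr i hMN₂) h263i DE (Finset.insertNone DK) (N := fun o : Option κ => o.elim Pl N) (z := fun o : Option κ => o.elim ζ z)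
    hG hGout hEG hcf hcfS hc₀ hc₀S hI1 hIS hLip hN'maj hz'le hD
  rw [hsum, mul_assoc]
  refine hasMajorant_mono _ key fun y y' => le_of_eq ?_
  rw [Finset.card_insertNone]
  push_cast
  ring

/-! ## §2  The same for `K_{□,□} = kDiag (∂P∂*) h_□ ζ_□ M_□ P_□` of (2.92) BY NAME -/

/-- **(2.134) FOR `K_{□,□}G_□h_□` WITH `K_{□,□} = …B6Eq291Generator.kDiag (∂P∂*) h_□ ζ_□ M_□ P_□` BY NAME** (`kDiag Dg h z m p = (hm − mh) + z(Dg − p)h +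
z(ph − hp)`: lines 1–2 = the commutator of `h_□` with the `T_□`-version `M_□` of `Δ + Q*aQ`, line 3 = the change of domain `ζ_□(∂P∂* − ∂P_□∂*)h_□`, line 4 =
`ζ_□[∂P_□∂*, h_□] = ζ_□P_{□,1}(∂h_□)`), any `∂P∂* =: Dg`: under the displayed decomposition `hdec` of the commutator into line 1
(first-order form) + line 2 (kernel commutators), the (2.88)-shape majorant of `P_□ =: Pl`, the change-of-domain majorant of `ζ_□(∂P∂* − P_□)h_□` and the data of
`ineq2134_diag_kLevel` — for every member above ONE threshold: `HasMajorant blk ((K_{□,□}·G_□)·h_□) (θ_diag·e^{−½δ d})` with r03's explicit `θ_diag`.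
[cite: Balaban1984PropagatorsII, (2.134) p.247; (2.92) p.239] -/
theorem ineq2134_kDiag_kLevel (d ℓ : ℕ) {δ : ℝ} (hδ : 0 < δ) :
    ∃ M₀ c : ℝ, 0 < M₀ ∧ 0 ≤ c ∧
      ∀ i : KIdx d ℓ, M₀ ≤ ((ℓ : ℝ) + 1) * i.Mh →
        ∀ {X : Type} (blk : X → (geoB i).Site) (Dg : Module.End ℝ (X → ℝ)),
        ∀ {CG C₁ CN CD cD s s₁ s₂ r₀ : ℝ}, 0 ≤ CG → 0 ≤ C₁ → 0 ≤ CN → 0 ≤ CD → 0 ≤ s → 0 ≤ s₁ → 0 ≤ s₂ → 0 ≤ r₀ →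
        ∀ {Gl Ml Pl : Module.End ℝ (X → ℝ)} {hI c₀ ζ : X → ℝ} {S : Set (geoB i).Site}
          {ι : Type} (DE : Finset ι) {E : ι → Module.End ℝ (X → ℝ)} {cf : ι → X → ℝ}
          {κ : Type} (DK : Finset κ) {N : κ → Module.End ℝ (X → ℝ)} {z : κ → X → ℝ},
          mulOp hI * Ml - Ml * mulOp hI =
            (∑ e ∈ DE, mulOp (cf e) * E e - mulOp c₀) + ∑ k ∈ DK, mulOp (z k) * (N k * mulOp hI - mulOp hI * N k) →
          LocalMajorant blk Gl S (fun y y' => CG * (geoB i).len y ^ 2 * Real.exp (-(δ * (geoB i).dist y y'))) →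
          OutLoc blk Gl S →
          (∀ e ∈ DE, LocalMajorant blk (E e * Gl) S (fun y y' => C₁ * (geoB i).len y * Real.exp (-(δ * (geoB i).dist y y')))) →
          (∀ e ∈ DE, ∀ x, |cf e x| ≤ s₁ / ((geoB i).M * (geoB i).len (blk x))) → (∀ e ∈ DE, ∀ x, cf e x ≠ 0 → blk x ∈ S) →
          (∀ x, |c₀ x| ≤ s₂ / ((geoB i).M * (geoB i).len (blk x) ^ 2)) → (∀ x, c₀ x ≠ 0 → blk x ∈ S) →
          (∀ x, |hI x| ≤ 1) → (∀ x, hI x ≠ 0 → blk x ∈ S) →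
          (∀ x x', |hI x' - hI x| ≤ s / (geoB i).M * ((geoB i).dist (blk x) (blk x') + r₀)) →
          (∀ k ∈ DK, HasMajorant blk (N k) (fun y y'' => CN / (geoB i).len y ^ 2 * Real.exp (-(δ * (geoB i).dist y y'')))) →
          (∀ k ∈ DK, ∀ x, |z k x| ≤ 1) →
          HasMajorant blk Pl (fun y y'' => CN / (geoB i).len y ^ 2 * Real.exp (-(δ * (geoB i).dist y y''))) →
          (∀ x, |ζ x| ≤ 1) →
          HasMajorant blk (mulOp ζ * (Dg - Pl) * mulOp hI)
            (fun y y'' => CD * Real.exp (-(cD * (geoB i).M)) / (geoB i).len y ^ 2 * Real.exp (-(δ * (geoB i).dist y y''))) →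
          HasMajorant blk ((kDiag Dg (mulOp hI) (mulOp ζ) Ml Pl * Gl) * mulOp hI)
            (fun y y' =>
              ((DE.card * (s₁ * C₁) + s₂ * CG) / (geoB i).M +
                    (DK.card + 1) * (s / (geoB i).M * (CN * CG * (geoB i).L ^ 2 * (8 / δ + r₀)) * c ^ 2) +
                  CD * Real.exp (-(cD * (geoB i).M)) * CG * (geoB i).L ^ 2 * c ^ 2) *
                Real.exp (-(1 / 2 * δ * (geoB i).dist y y'))) := by
  obtain ⟨M₀, c, hM₀, hc, hall⟩ := ineq2134_diag_kLevel d ℓ hδ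
  refine ⟨M₀, c, hM₀, hc, ?_⟩
  intro i hM X blk Dg CG C₁ CN CD cD s s₁ s₂ r₀ hCG hC₁ hCN hCD hs hs₁ hs₂ hr₀ Gl Ml Pl hI c₀ ζ S ι DE E cf κ DK N z hdec hG hGout hEG hcf
    hcfS hc₀ hc₀S hI1 hIS hLip hN hz hPl hζ hD
  have key := hall i hM blk hCG hC₁ hCN hCD hs hs₁ hs₂ hr₀ (Gl := Gl) (Pl := Pl) (D₃ := mulOp ζ * (Dg - Pl) * mulOp hI) (ζ := ζ)
    DE DK hG hGout hEG hcf hcfS hc₀ hc₀S hI1 hIS hLip hN hz hPl hζ hD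
  -- `kDiag` = line 1 + (line 2 + line 4) + line 3, by `hdec`
  have e : kDiag Dg (mulOp hI) (mulOp ζ) Ml Pl =
      ((∑ e ∈ DE, mulOp (cf e) * E e - mulOp c₀) +
          ((∑ k ∈ DK, mulOp (z k) * (N k * mulOp hI - mulOp hI * N k)) + mulOp ζ * (Pl * mulOp hI - mulOp hI * Pl))) +
        mulOp ζ * (Dg - Pl) * mulOp hI := by
    unfold kDiag
    rw [hdec]
    abel
  rw [e]
  exact key

/-! ## §3  The printed `O(M⁻¹)` packaged: `θ_diag ≤ Θ·U/M` -/

/-- `e^{−x} ≤ x⁻¹` for `x > 0` (the change-of-domain factor `e^{−c_DM}` is `O(M⁻¹)`). [folklore] -/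
private theorem exp_neg_le_inv {x : ℝ} (hx : 0 < x) : Real.exp (-x) ≤ x⁻¹ := by
  rw [Real.exp_neg]
  exact inv_anti₀ hx ((by linarith : x ≤ x + 1).trans (Real.add_one_le_exp x))

/-- `a ≤ (a+1)(b+1)` for `a, b ≥ 0`. [folklore] -/
private theorem le_mul_succ_left {a b : ℝ} (ha : 0 ≤ a) (hb : 0 ≤ b) : a ≤ (a + 1) * (b + 1) := by nlinarith

/-- `b ≤ (a+1)(b+1)` for `a, b ≥ 0`. [folklore] -/
private theorem le_mul_succ_right {a b : ℝ} (ha : 0 ≤ a) (hb : 0 ≤ b) : b ≤ (a + 1) * (b + 1) := by nlinarith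

/-- THE SCALAR PACKAGING `θ_diag ≤ Θ·U/M`: r03's `θ_diag` (with a partner constant `C_N′ ≤ (C_N+1)(C_P′+1)`) is at most
`(L²c²(C_P′+1)(8/δ+1) + 1)·(n_E s₁C₁ + s₂C_G + (n_K+1)·s·((C_N+1)C_G(1+r₀)) + C_DC_G/c_D)·M⁻¹` (`8/δ + r₀ ≤ (8/δ+1)(1+r₀)`, `e^{−c_DM} ≤ (c_DM)⁻¹`).
[cite: Balaban1984PropagatorsII, (2.134) p.247 («O(M^{−1})»), bookkeeping] -/
theorem theta_pack_le {L c CP CN' CN CG C₁ CD cD s s₁ s₂ r₀ δ M : ℝ} (nE nK : ℕ) (hM : 0 < M) (hδ : 0 < δ) (hCP : 0 ≤ CP)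
    (hCN'0 : 0 ≤ CN') (hCN' : CN' ≤ (CN + 1) * (CP + 1)) (hCN : 0 ≤ CN) (hCG : 0 ≤ CG) (hC₁ : 0 ≤ C₁) (hCD : 0 ≤ CD) (hcD : 0 < cD)
    (hs : 0 ≤ s) (hs₁ : 0 ≤ s₁) (hs₂ : 0 ≤ s₂) (hr₀ : 0 ≤ r₀) :
    (nE * (s₁ * C₁) + s₂ * CG) / M + (nK + 1) * (s / M * (CN' * CG * L ^ 2 * (8 / δ + r₀)) * c ^ 2) +
        CD * Real.exp (-(cD * M)) * CG * L ^ 2 * c ^ 2 ≤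
      (L ^ 2 * c ^ 2 * (CP + 1) * (8 / δ + 1) + 1) *
        (nE * (s₁ * C₁) + s₂ * CG + (nK + 1) * s * ((CN + 1) * CG * (1 + r₀)) + CD * CG / cD) * M⁻¹ := by
  have h8 : 8 / δ + r₀ ≤ (8 / δ + 1) * (1 + r₀) := by
    have h0 : 0 ≤ 8 / δ := by positivity
    have e : (8 / δ + 1) * (1 + r₀) = 8 / δ + r₀ + (8 / δ * r₀ + 1) := by ring
    rw [e]
    linarith [mul_nonneg h0 hr₀]
  have hΘ0 : 0 ≤ L ^ 2 * c ^ 2 * (CP + 1) * (8 / δ + 1) := by positivity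
  have hΘ1 : 1 ≤ L ^ 2 * c ^ 2 * (CP + 1) * (8 / δ + 1) + 1 := by linarith
  have hL2 : L ^ 2 * c ^ 2 ≤ L ^ 2 * c ^ 2 * (CP + 1) * (8 / δ + 1) + 1 := by
    have h0 : 0 ≤ 8 / δ := by positivity
    have h1 : 1 ≤ (CP + 1) * (8 / δ + 1) := one_le_mul_of_one_le_of_one_le (by linarith) (by linarith)
    have h2 : 0 ≤ L ^ 2 * c ^ 2 := by positivity
    have h3 : L ^ 2 * c ^ 2 * 1 ≤ L ^ 2 * c ^ 2 * ((CP + 1) * (8 / δ + 1)) := mul_le_mul_of_nonneg_left h1 h2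
    have h4 : L ^ 2 * c ^ 2 * ((CP + 1) * (8 / δ + 1)) = L ^ 2 * c ^ 2 * (CP + 1) * (8 / δ + 1) := by ring
    linarith
  -- the commutator term
  have hmid : CN' * CG * L ^ 2 * (8 / δ + r₀) * c ^ 2 ≤ (L ^ 2 * c ^ 2 * (CP + 1) * (8 / δ + 1) + 1) * ((CN + 1) * CG * (1 + r₀)) := by
    have ha : CN' * CG * L ^ 2 ≤ (CN + 1) * (CP + 1) * CG * L ^ 2 :=
      mul_le_mul_of_nonneg_right (mul_le_mul_of_nonneg_right hCN' hCG) (sq_nonneg _)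
    have hb : 0 ≤ CN' * CG * L ^ 2 := by positivity
    have h1 : CN' * CG * L ^ 2 * (8 / δ + r₀) * c ^ 2 ≤ ((CN + 1) * (CP + 1) * CG * L ^ 2) * ((8 / δ + 1) * (1 + r₀)) * c ^ 2 :=
      mul_le_mul_of_nonneg_right (mul_le_mul ha h8 (by positivity) (by positivity)) (sq_nonneg _)
    have h2 : ((CN + 1) * (CP + 1) * CG * L ^ 2) * ((8 / δ + 1) * (1 + r₀)) * c ^ 2 =
        (L ^ 2 * c ^ 2 * (CP + 1) * (8 / δ + 1)) * ((CN + 1) * CG * (1 + r₀)) := by ring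
    have h3 : (L ^ 2 * c ^ 2 * (CP + 1) * (8 / δ + 1)) * ((CN + 1) * CG * (1 + r₀)) ≤
        (L ^ 2 * c ^ 2 * (CP + 1) * (8 / δ + 1) + 1) * ((CN + 1) * CG * (1 + r₀)) :=
      mul_le_mul_of_nonneg_right (by linarith) (by positivity)
    linarith [h1, h2, h3]
  -- the change-of-domain term
  have hdom : CD * Real.exp (-(cD * M)) * CG * L ^ 2 * c ^ 2 ≤ (L ^ 2 * c ^ 2 * (CP + 1) * (8 / δ + 1) + 1) * (CD * CG / cD) * M⁻¹ := by
    have he : Real.exp (-(cD * M)) ≤ (cD * M)⁻¹ := exp_neg_le_inv (mul_pos hcD hM)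
    have h1 : CD * Real.exp (-(cD * M)) * CG * L ^ 2 * c ^ 2 ≤ CD * (cD * M)⁻¹ * CG * L ^ 2 * c ^ 2 := by
      have : 0 ≤ CG * L ^ 2 * c ^ 2 := by positivity
      calc CD * Real.exp (-(cD * M)) * CG * L ^ 2 * c ^ 2 = CD * Real.exp (-(cD * M)) * (CG * L ^ 2 * c ^ 2) := by ring
        _ ≤ CD * (cD * M)⁻¹ * (CG * L ^ 2 * c ^ 2) := mul_le_mul_of_nonneg_right (mul_le_mul_of_nonneg_left he hCD) this
        _ = _ := by ring
    have h2 : CD * (cD * M)⁻¹ * CG * L ^ 2 * c ^ 2 = (L ^ 2 * c ^ 2) * (CD * CG / cD) * M⁻¹ := by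
      field_simp
    have h3 : (L ^ 2 * c ^ 2) * (CD * CG / cD) * M⁻¹ ≤ (L ^ 2 * c ^ 2 * (CP + 1) * (8 / δ + 1) + 1) * (CD * CG / cD) * M⁻¹ :=
      mul_le_mul_of_nonneg_right (mul_le_mul_of_nonneg_right hL2 (by positivity)) (inv_nonneg.2 hM.le)
    linarith [h1, h2, h3]
  -- the first two terms
  have hMi : 0 < M⁻¹ := inv_pos.2 hM
  have e1 : (nE * (s₁ * C₁) + s₂ * CG) / M + (nK + 1) * (s / M * (CN' * CG * L ^ 2 * (8 / δ + r₀)) * c ^ 2) =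
      ((nE * (s₁ * C₁) + s₂ * CG) + (nK + 1) * s * (CN' * CG * L ^ 2 * (8 / δ + r₀) * c ^ 2)) * M⁻¹ := by
    field_simp
  have h12 : ((nE * (s₁ * C₁) + s₂ * CG) + (nK + 1) * s * (CN' * CG * L ^ 2 * (8 / δ + r₀) * c ^ 2)) * M⁻¹ ≤
      (L ^ 2 * c ^ 2 * (CP + 1) * (8 / δ + 1) + 1) * (nE * (s₁ * C₁) + s₂ * CG + (nK + 1) * s * ((CN + 1) * CG * (1 + r₀))) * M⁻¹ := by
    refine mul_le_mul_of_nonneg_right ?_ hMi.le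
    have hT1 : 0 ≤ (nE : ℝ) * (s₁ * C₁) + s₂ * CG := by positivity
    have hA : (nE : ℝ) * (s₁ * C₁) + s₂ * CG ≤ (L ^ 2 * c ^ 2 * (CP + 1) * (8 / δ + 1) + 1) * (nE * (s₁ * C₁) + s₂ * CG) :=
      le_mul_of_one_le_left hT1 hΘ1
    have hB : (nK + 1 : ℝ) * s * (CN' * CG * L ^ 2 * (8 / δ + r₀) * c ^ 2) ≤
        (L ^ 2 * c ^ 2 * (CP + 1) * (8 / δ + 1) + 1) * ((nK + 1 : ℝ) * s * ((CN + 1) * CG * (1 + r₀))) :=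
      calc (nK + 1 : ℝ) * s * (CN' * CG * L ^ 2 * (8 / δ + r₀) * c ^ 2)
          ≤ (nK + 1 : ℝ) * s * ((L ^ 2 * c ^ 2 * (CP + 1) * (8 / δ + 1) + 1) * ((CN + 1) * CG * (1 + r₀))) :=
            mul_le_mul_of_nonneg_left hmid (by positivity)
        _ = _ := by ring
    calc (nE : ℝ) * (s₁ * C₁) + s₂ * CG + (nK + 1) * s * (CN' * CG * L ^ 2 * (8 / δ + r₀) * c ^ 2)
        ≤ (L ^ 2 * c ^ 2 * (CP + 1) * (8 / δ + 1) + 1) * (nE * (s₁ * C₁) + s₂ * CG) +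
            (L ^ 2 * c ^ 2 * (CP + 1) * (8 / δ + 1) + 1) * ((nK + 1 : ℝ) * s * ((CN + 1) * CG * (1 + r₀))) := add_le_add hA hB
      _ = _ := by ring
  rw [e1]
  have hsplit : (L ^ 2 * c ^ 2 * (CP + 1) * (8 / δ + 1) + 1) *
        (nE * (s₁ * C₁) + s₂ * CG + (nK + 1) * s * ((CN + 1) * CG * (1 + r₀)) + CD * CG / cD) * M⁻¹ =
      (L ^ 2 * c ^ 2 * (CP + 1) * (8 / δ + 1) + 1) * (nE * (s₁ * C₁) + s₂ * CG + (nK + 1) * s * ((CN + 1) * CG * (1 + r₀))) * M⁻¹ +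
        (L ^ 2 * c ^ 2 * (CP + 1) * (8 / δ + 1) + 1) * (CD * CG / cD) * M⁻¹ := by ring
  rw [hsplit]
  exact add_le_add h12 hdom

/-- **(2.134) FOR `K_{□,□}G_□h_□`, THE `O(M⁻¹)` PACKAGED: `θ₀ = Θ·U/M`.**  For every rate `δ > 0` there are `M₀ > 0` and `Θ ≥ 0` (on `d, L, δ` only) such that
for every member with `L·M_h ≥ M₀`, all constants `C_G, C₁, C_N, C_D, s, s₁, s₂, r₀ ≥ 0`, `c_D > 0` and all data as in `ineq2134_kDiag_kLevel` (print's `G_□` with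
ITS OWN two-scale `P_□ =: Pl`, p. 239, (2.88)-shape majorant; line 3 `ζ_□(∂P∂* − ∂P_□∂*)h_□` with the change-of-domain majorant `C_De^{−c_DM}(L^jη)^{−2}e^{−δd}`,
p. 238): `HasMajorant blk ((K_{□,□}·G_□)·h_□) (θ₀·e^{−(δ/2)d(y,y′)})` with **`θ₀ = Θ·U/M`**, `M = L·M_h`,
`U = #E·s₁C₁ + s₂C_G + (#K+1)·s·((C_N+1)C_G(1+r₀)) + C_DC_G/c_D` — the printed `O(M⁻¹)`, every factor located; literally the hypothesis `h2134` of
`…B6Prop26Gluing.majorant_R_of_2134` / `prop26_2136_of_2133_2134(_lemma21)` for the pair (□, □) (`Kt □ □ = K_{□,□}G_□`), AT THE GIVEN RATE `δ`.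
[cite: Balaban1984PropagatorsII, (2.134) p.247; (2.92) p.239; p.238 (remarks)] -/
theorem ineq2134_kDiag_kLevel_theta (d ℓ : ℕ) {δ : ℝ} (hδ : 0 < δ) :
    ∃ M₀ Θ : ℝ, 0 < M₀ ∧ 0 ≤ Θ ∧
      ∀ i : KIdx d ℓ, M₀ ≤ ((ℓ : ℝ) + 1) * i.Mh →
        ∀ {X : Type} (blk : X → (geoB i).Site) (Dg : Module.End ℝ (X → ℝ)),
        ∀ {CG C₁ CN CD cD s s₁ s₂ r₀ : ℝ}, 0 ≤ CG → 0 ≤ C₁ → 0 ≤ CN → 0 ≤ CD → 0 < cD → 0 ≤ s → 0 ≤ s₁ → 0 ≤ s₂ → 0 ≤ r₀ →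
        ∀ {Gl Ml Pl : Module.End ℝ (X → ℝ)} {hI c₀ ζ : X → ℝ} {S : Set (geoB i).Site}
          {ι : Type} (DE : Finset ι) {E : ι → Module.End ℝ (X → ℝ)} {cf : ι → X → ℝ}
          {κ : Type} (DK : Finset κ) {N : κ → Module.End ℝ (X → ℝ)} {z : κ → X → ℝ},
          mulOp hI * Ml - Ml * mulOp hI =
            (∑ e ∈ DE, mulOp (cf e) * E e - mulOp c₀) + ∑ k ∈ DK, mulOp (z k) * (N k * mulOp hI - mulOp hI * N k) →
          LocalMajorant blk Gl S (fun y y' => CG * (geoB i).len y ^ 2 * Real.exp (-(δ * (geoB i).dist y y'))) →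
          OutLoc blk Gl S →
          (∀ e ∈ DE, LocalMajorant blk (E e * Gl) S (fun y y' => C₁ * (geoB i).len y * Real.exp (-(δ * (geoB i).dist y y')))) →
          (∀ e ∈ DE, ∀ x, |cf e x| ≤ s₁ / ((geoB i).M * (geoB i).len (blk x))) → (∀ e ∈ DE, ∀ x, cf e x ≠ 0 → blk x ∈ S) →
          (∀ x, |c₀ x| ≤ s₂ / ((geoB i).M * (geoB i).len (blk x) ^ 2)) → (∀ x, c₀ x ≠ 0 → blk x ∈ S) →
          (∀ x, |hI x| ≤ 1) → (∀ x, hI x ≠ 0 → blk x ∈ S) →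
          (∀ x x', |hI x' - hI x| ≤ s / (geoB i).M * ((geoB i).dist (blk x) (blk x') + r₀)) →
          (∀ k ∈ DK, HasMajorant blk (N k) (fun y y'' => CN / (geoB i).len y ^ 2 * Real.exp (-(δ * (geoB i).dist y y'')))) →
          (∀ k ∈ DK, ∀ x, |z k x| ≤ 1) →
          HasMajorant blk Pl (fun y y'' => CN / (geoB i).len y ^ 2 * Real.exp (-(δ * (geoB i).dist y y''))) →
          (∀ x, |ζ x| ≤ 1) →
          HasMajorant blk (mulOp ζ * (Dg - Pl) * mulOp hI)
            (fun y y'' => CD * Real.exp (-(cD * (geoB i).M)) / (geoB i).len y ^ 2 * Real.exp (-(δ * (geoB i).dist y y''))) →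
          HasMajorant blk ((kDiag Dg (mulOp hI) (mulOp ζ) Ml Pl * Gl) * mulOp hI)
            (fun y y' => Θ * (DE.card * (s₁ * C₁) + s₂ * CG + (DK.card + 1) * s * ((CN + 1) * CG * (1 + r₀)) + CD * CG / cD) *
              ((geoB i).M)⁻¹ * Real.exp (-(δ / 2 * (geoB i).dist y y'))) := by
  obtain ⟨M₀, c, hM₀, hc, hall⟩ := ineq2134_kDiag_kLevel d ℓ hδ
  obtain ⟨Θ, hΘ⟩ : ∃ Θ : ℝ, Θ = ((ℓ : ℝ) + 1) ^ 2 * c ^ 2 * (0 + 1) * (8 / δ + 1) + 1 := ⟨_, rfl⟩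
  have hΘnn : 0 ≤ Θ := by rw [hΘ]; positivity
  refine ⟨M₀, Θ, hM₀, hΘnn, ?_⟩
  intro i hM X blk Dg CG C₁ CN CD cD s s₁ s₂ r₀ hCG hC₁ hCN hCD hcD hs hs₁ hs₂ hr₀ Gl Ml Pl hI c₀ ζ S ι DE E cf κ DK N z hdec hG hGout hEG hcf
    hcfS hc₀ hc₀S hI1 hIS hLip hN hz hPl hζ hD
  have hMpos : 0 < (geoB i).M := (member_facts i).2.2.1
  have key := hall i hM blk Dg hCG hC₁ hCN hCD hs hs₁ hs₂ hr₀ DE DK hdec hG hGout hEG hcf hcfS hc₀ hc₀S hI1 hIS hLip hN hz hPl hζ hD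
  refine hasMajorant_mono _ key fun y y' => ?_
  have hθ := theta_pack_le (L := (geoB i).L) (c := c) (CP := 0) (CN' := CN) DE.card DK.card hMpos hδ le_rfl hCN (le_mul_succ_left hCN le_rfl) hCN hCG hC₁
    hCD hcD hs hs₁ hs₂ hr₀
  rw [geoB_L] at hθ ⊢
  rw [← hΘ] at hθ
  have h1 : Real.exp (-(1 / 2 * δ * (geoB i).dist y y')) = Real.exp (-(δ / 2 * (geoB i).dist y y')) := by ring_nf
  rw [h1]
  exact mul_le_mul_of_nonneg_right hθ (Real.exp_nonneg _)

end Literature.MathematicalPhysics.QuantumFieldTheory.Balaban1983to89.B6Ineq2134DiagKLevel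

end
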